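import Literature.Geometry.Riemannian.MetricFlowFiniteTimeSubconvergenceAux1
import Literature.Geometry.Riemannian.MetricFlowFiniteTimeSubconvergenceAux3
import Literature.Geometry.Riemannian.WassersteinW1LimitPoints
import Literature.Analysis.FunctionSpaces.DiagonalSubsequence
import HarnessLib

/-!
# Subconvergence within a correspondence over finitely many times — the limit kernels
# (Bamler 2023, §7.3, Lemma 7.? (arXiv v1 Lemma 161), proof: Claim 7.? (arXiv v1 Claim 162) at
# all base points, after one diagonal subsequence)

R. Bamler, *Compactness theory of the space of super Ricci flows*, Invent. Math. 233 (2023), §7.3,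
proof of the Lemma on Cauchy sequences within a correspondence over a finite set of times (arXiv
v1 Lemma 161). Claim (arXiv v1 Claim 162): *"Let `1 ≤ l ≤ k ≤ N` and `x^∞ ∈ X^∞_{t_k}`. Then, after
passing to a subsequence, there is a probability measure `ν^∞_{x^∞;t_l} ∈ 𝒫(X^∞_{t_l})` such that
for any sequence `xⁱ ∈ 𝒳ⁱ_{t_k}` with `φⁱ_{t_k}(xⁱ) → φ^∞_{t_k}(x^∞)` we have
`(φⁱ_{t_l})_* νⁱ_{xⁱ;t_l} → (φ^∞_{t_l})_* ν^∞_{x^∞;t_l}` in `W₁`"* (7.22), and: *"Since the spaces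
`X^∞_{t_k}` are separable and the maps `(𝒳ⁱ_{t_k}, dⁱ_{t_k}) → (𝒫(Z_{t_l}), d^{Z_{t_l}}_{W₁})`,
`y ↦ (φⁱ_{t_l})_* νⁱ_{y;t_l}` are `1`-Lipschitz, we may pass to a subsequence and assume that
(7.22) holds for all `1 ≤ l ≤ k ≤ N`, `x^∞ ∈ X^∞_{t_k}`"*.

This file performs that passage, taking the subsequential statement of Claim 162 — in the
abstract form `exists_subseq_tendsto_map_kernel` of `MetricFlowKernelSubconvergence.lean` — as a
HYPOTHESIS `h162` (it is proved separately), for a sequence of `H`-concentrated metric flow pairs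
`P n` in a correspondence `ℭ` over a countable set of times `I₀` with Polish comparison spaces and
`W₁`-convergent slice measures `(φⁿ_t)_* μⁿ_t → m_t` (the output of
`MetricFlowPair.exists_subseq_familyCorrespondence_tendsto`):

* `MetricFlowPair.exists_subseq_limit_kernels` — after ONE further subsequence `ψ` (Cantor's
  diagonal procedure, `exists_strictMono_forall_of_extraction'`, over the countably many triples
  `(t_l < t_k, x^∞)` with `x^∞` in a dense sequence `D` of `supp m_{t_k}`), for every pair
  `s < t` in `I₀` there is a `1`-Lipschitz family `K : supp m_t → 𝒫(Z_s)` of probability measures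
  (the limit kernels `(φ^∞_s)_* ν^∞_{·;s}`, extended from `D` by `exists_lipschitz_kernel_extension`)
  with `(φ^{ψ n}_s)_* ν^{ψ n}_{xⁿ;s} → K(D k)` in `W₁` along chosen base points `xⁿ = xD k n` with
  `φ^{ψ n}_t(xⁿ) → D k`. The inputs of `h162` are read off the flows by
  `MetricFlow.gradient_property_zero`, `IsHConcentrated.variance_condKernel_self_le_ofReal`,
  `IsConjugateHeatFlow.lintegral_eq_lintegral_lintegral_condKernel`; the approximating base points
  come from `exists_seq_tendsto_of_mem_support_of_tendsto_wassersteinW1_map`.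

Everything is proved; no definitions, no named facts.

## References

* R. H. Bamler, *Compactness theory of the space of super Ricci flows*, Invent. Math. 233 (2023),
  1121–1277 (arXiv:2008.09298), §7.3, Lemma 7.? (arXiv v1 Lemma 161), proof, Claim 7.? (arXiv v1
  Claim 162), (7.22). [Bamler2023]
* G. Seregin, *Lecture Notes on Regularity Theory for the Navier–Stokes Equations* (2014), App. B
  §B.4 (the diagonal procedure). [Seregin2014]
-/

noncomputable section

open Set MeasureTheory Filter TopologicalSpace Function
open scoped Topology ENNReal NNReal

namespace Literature.Geometry.Riemannian

universe u

namespace MetricFlowPair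

open MetricFlow Literature.Analysis.FunctionSpaces

/-- **Bamler 2023, proof of Lemma 7.? (arXiv v1 Lemma 161): Claim 7.? (arXiv v1 Claim 162) at all
base points after one diagonal subsequence.** Given the subsequential convergence of the pushed
conjugate heat kernels at one converging sequence of base points (`h162`, the abstract Claim 162),
`H`-concentrated metric flow pairs `P n` in a correspondence `ℭ` over a countable `I₀` with
complete separable comparison spaces, and `W₁`-limits `m_t` of `(φⁿ_t)_* μⁿ_t`, there is a
subsequence `ψ` such that for all `s < t` in `I₀`: a `1`-Lipschitz family `K : supp m_t → 𝒫(Z_s)`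
of probability measures, a dense sequence `D` of `supp m_t` and base points `xD k n ∈ 𝒳^{ψ n}_t`
with `φ^{ψ n}_t(xD k n) → D k` and `d_{W₁}((φ^{ψ n}_s)_* ν^{ψ n}_{xD k n;s}, K (D k)) → 0`. Proof as
printed: Claim 162 at the countably many `(s, t, D k)` along nested subsequences and the diagonal
(`exists_strictMono_forall_of_extraction'`); the limits are `1`-Lipschitz on `D`
(`wassersteinW1_limit_le_edist_of_tendsto`) and extend to `supp m_t`
(`exists_lipschitz_kernel_extension`).
[cite: Bamler2023, §7.3, Lemma 7.? (arXiv v1 Lemma 161), proof, Claim 7.? (arXiv v1 Claim 162)] -/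
theorem exists_subseq_limit_kernels
    (h162 : ∀ {Zk Zl : Type u} [MetricSpace Zk] [MeasurableSpace Zk] [BorelSpace Zk]
      [SecondCountableTopology Zk] [CompleteSpace Zk] [MetricSpace Zl] [MeasurableSpace Zl]
      [BorelSpace Zl] [SecondCountableTopology Zl] [CompleteSpace Zl] {Xk Xl : ℕ → Type u}
      [∀ n, MetricSpace (Xk n)] [∀ n, MeasurableSpace (Xk n)] [∀ n, BorelSpace (Xk n)]
      [∀ n, SecondCountableTopology (Xk n)] [∀ n, MetricSpace (Xl n)]
      [∀ n, MeasurableSpace (Xl n)] [∀ n, BorelSpace (Xl n)] [∀ n, SecondCountableTopology (Xl n)]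
      [∀ n, CompleteSpace (Xl n)] (φk : ∀ n, Xk n → Zk) (φl : ∀ n, Xl n → Zl)
      (hφk : ∀ n, Isometry (φk n)) (hφl : ∀ n, Isometry (φl n))
      (κ : ∀ n, Xk n → Measure (Xl n)) [∀ n x, IsProbabilityMeasure (κ n x)] {L : ℝ≥0} {W : ℝ}
      (hgrad : ∀ n (v : Xl n → ℝ), Measurable v → (∀ y, v y ∈ Icc (0 : ℝ) 1) →
        (∃ c, ∀ x, ∫ y, v y ∂κ n x = c) ∨
          ∃ f : Xk n → ℝ, LipschitzWith L f ∧ ∀ x, ∫ y, v y ∂κ n x = MetricFlow.Phi (f x))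
      (hvar : ∀ n x, variance (κ n x) (κ n x) ≤ ENNReal.ofReal W) (μk : ∀ n, Measure (Xk n))
      (μl : ∀ n, Measure (Xl n)) [∀ n, IsProbabilityMeasure (μk n)]
      [∀ n, IsProbabilityMeasure (μl n)]
      (hchf : ∀ n (f : Xl n → ℝ≥0∞), Measurable f →
        ∫⁻ y, f y ∂μl n = ∫⁻ x, ∫⁻ y, f y ∂κ n x ∂μk n)
      (mk : Measure Zk) (ml : Measure Zl) [IsProbabilityMeasure mk] [IsProbabilityMeasure ml]
      (hmk : Tendsto (fun n ↦ wassersteinW1 ((μk n).map (φk n)) mk) atTop (𝓝 0))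
      (hml : Tendsto (fun n ↦ wassersteinW1 ((μl n).map (φl n)) ml) atTop (𝓝 0)) {x : Zk}
      (hx : x ∈ mk.support) (xn : ∀ n, Xk n) (hxn : Tendsto (fun n ↦ φk n (xn n)) atTop (𝓝 x)),
      ∃ ψ : ℕ → ℕ, StrictMono ψ ∧ ∃ ν : Measure Zl, IsProbabilityMeasure ν ∧
        ν.support ⊆ ml.support ∧
        Tendsto (fun n ↦ wassersteinW1 ((κ (ψ n) (xn (ψ n))).map (φl (ψ n))) ν) atTop (𝓝 0))
    {J : Set ℝ} {H : ℝ} (P : ℕ → MetricFlowPair.{u} J) (hP : ∀ n, (P n).flow.IsHConcentrated H)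
    {I₀ : Set ℝ} (hI₀ : I₀.Countable) (ℭ : FamilyCorrespondence (fun n ↦ (P n).flow) I₀)
    (hfull : ℭ.FullyDefinedOver I₀) [∀ t, SecondCountableTopology (ℭ.Z t)]
    [∀ t, CompleteSpace (ℭ.Z t)] (m : ∀ t : I₀, Measure (ℭ.Z t))
    [∀ t, IsProbabilityMeasure (m t)]
    (hconv : ∀ t (ht : t ∈ I₀), Tendsto (fun n ↦ wassersteinW1
      (((P n).μ ⟨t, (ℭ.dom_subset n (hfull n ht)).1⟩).map (ℭ.φ n t (hfull n ht))) (m ⟨t, ht⟩))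
      atTop (𝓝 0)) :
    ∃ ψ : ℕ → ℕ, StrictMono ψ ∧
      ∀ (s : ℝ) (hs : s ∈ I₀) (t : ℝ) (ht : t ∈ I₀), s < t →
        ∃ (K : (m ⟨t, ht⟩).support → Measure (ℭ.Z ⟨s, hs⟩)) (D : ℕ → (m ⟨t, ht⟩).support)
          (xD : ℕ → ∀ n, (P (ψ n)).flow.Slice ⟨t, (ℭ.dom_subset (ψ n) (hfull (ψ n) ht)).1⟩),
          (∀ y, IsProbabilityMeasure (K y)) ∧
          (∀ y y', wassersteinW1 (K y) (K y') ≤ edist y y') ∧ DenseRange D ∧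
          (∀ k, Tendsto (fun n ↦ ℭ.φ (ψ n) t (hfull (ψ n) ht) (xD k n)) atTop
            (𝓝 ((D k : (m ⟨t, ht⟩).support) : ℭ.Z ⟨t, ht⟩))) ∧
          ∀ k, Tendsto (fun n ↦ wassersteinW1
            (((P (ψ n)).flow.condKernel (xD k n)
                ⟨s, (ℭ.dom_subset (ψ n) (hfull (ψ n) hs)).1⟩).map (ℭ.φ (ψ n) s (hfull (ψ n) hs)))
            (K (D k))) atTop (𝓝 0) := by
  classical
  haveI : ∀ n (t : (P n).I'), SecondCountableTopology ((P n).flow.Slice t) := fun n t ↦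
    UniformSpace.secondCountable_of_separable _
  haveI : ∀ n (t : (P n).I'), IsProbabilityMeasure ((P n).μ t) := fun n t ↦
    isProbabilityMeasure_μ _ _
  haveI : Countable I₀ := hI₀.to_subtype
  -- dense sequences in the supports of the limit measures
  set D : ∀ t : I₀, ℕ → (m t).support := fun t ↦ denseSeq _ with hD_def
  have hD : ∀ t, DenseRange (D t) := fun t ↦ denseRange_denseSeq _
  -- approximating base points `xD t k n ∈ 𝒳ⁿ_t`, `φⁿ_t (xD t k n) → D t k`
  have happ : ∀ (t : ℝ) (ht : t ∈ I₀) (k : ℕ),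
      ∃ x : ∀ n, (P n).flow.Slice ⟨t, (ℭ.dom_subset n (hfull n ht)).1⟩,
        Tendsto (fun n ↦ ℭ.φ n t (hfull n ht) (x n)) atTop
          (𝓝 ((D ⟨t, ht⟩ k : (m ⟨t, ht⟩).support) : ℭ.Z ⟨t, ht⟩)) := fun t ht k ↦
    exists_seq_tendsto_of_mem_support_of_tendsto_wassersteinW1_map
      (fun n ↦ ℭ.φ n t (hfull n ht)) (fun n ↦ ℭ.isometry n t _)
      (fun n ↦ (P n).μ ⟨t, (ℭ.dom_subset n (hfull n ht)).1⟩) (hconv t ht) (D ⟨t, ht⟩ k).2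
  choose xD hxD using happ
  -- the extraction property: Claim 162 at `(s, t, D t k)` holds along `ψ`
  let Q : (I₀ × I₀ × ℕ) → (ℕ → ℕ) → Prop := fun i ψ ↦ (i.1 : ℝ) < i.2.1 →
    ∃ ν : Measure (ℭ.Z i.1), IsProbabilityMeasure ν ∧
      Tendsto (fun n ↦ wassersteinW1
        (((P (ψ n)).flow.condKernel (xD i.2.1 i.2.1.2 i.2.2 (ψ n))
            ⟨i.1, (ℭ.dom_subset (ψ n) (hfull (ψ n) i.1.2)).1⟩).map
          (ℭ.φ (ψ n) i.1 (hfull (ψ n) i.1.2))) ν) atTop (𝓝 0)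
  have hsub : ∀ i (ψ ψ' : ℕ → ℕ),
      (∃ ρ : ℕ → ℕ, StrictMono ρ ∧ ∀ᶠ k in atTop, ψ' k = ψ (ρ k)) → Q i ψ → Q i ψ' := by
    rintro i ψ ψ' ⟨ρ, hρ, heq⟩ hQi hlt
    obtain ⟨ν, hν, hνt⟩ := hQi hlt
    exact ⟨ν, hν, tendsto_of_eventually_eq_comp (a := fun n ↦ wassersteinW1
      (((P n).flow.condKernel (xD i.2.1 i.2.1.2 i.2.2 n)
          ⟨i.1, (ℭ.dom_subset n (hfull n i.1.2)).1⟩).map (ℭ.φ n i.1 (hfull n i.1.2))) ν)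
      hρ heq hνt⟩
  have hex : ∀ i (ψ₀ : ℕ → ℕ), StrictMono ψ₀ → ∃ ψ : ℕ → ℕ, StrictMono ψ ∧ Q i (ψ₀ ∘ ψ) := by
    rintro ⟨s, t, k⟩ ψ₀ hψ₀
    by_cases hlt : (s : ℝ) < t
    · haveI : ∀ n (x : (P (ψ₀ n)).flow.Slice ⟨t, (ℭ.dom_subset (ψ₀ n) (hfull (ψ₀ n) t.2)).1⟩),
          IsProbabilityMeasure ((P (ψ₀ n)).flow.condKernel x
            ⟨s, (ℭ.dom_subset (ψ₀ n) (hfull (ψ₀ n) s.2)).1⟩) := fun n x ↦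
        (P (ψ₀ n)).flow.isProbabilityMeasure_condKernel x hlt.le
      obtain ⟨ψ, hψ, ν, hν, -, hνt⟩ := h162 (Zk := ℭ.Z t) (Zl := ℭ.Z s)
        (Xk := fun n ↦ (P (ψ₀ n)).flow.Slice ⟨t, (ℭ.dom_subset (ψ₀ n) (hfull (ψ₀ n) t.2)).1⟩)
        (Xl := fun n ↦ (P (ψ₀ n)).flow.Slice ⟨s, (ℭ.dom_subset (ψ₀ n) (hfull (ψ₀ n) s.2)).1⟩)
        (fun n ↦ ℭ.φ (ψ₀ n) t (hfull (ψ₀ n) t.2)) (fun n ↦ ℭ.φ (ψ₀ n) s (hfull (ψ₀ n) s.2))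
        (fun n ↦ ℭ.isometry _ _ _) (fun n ↦ ℭ.isometry _ _ _)
        (fun n x ↦ (P (ψ₀ n)).flow.condKernel x
          ⟨s, (ℭ.dom_subset (ψ₀ n) (hfull (ψ₀ n) s.2)).1⟩)
        (L := Real.toNNReal (1 / Real.sqrt ((t : ℝ) - s))) (W := H * ((t : ℝ) - s))
        (fun n v hv h01 ↦ (P (ψ₀ n)).flow.gradient_property_zero hlt v hv h01)
        (fun n x ↦ (hP (ψ₀ n)).variance_condKernel_self_le_ofReal hlt.le x)
        (fun n ↦ (P (ψ₀ n)).μ ⟨t, (ℭ.dom_subset (ψ₀ n) (hfull (ψ₀ n) t.2)).1⟩)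
        (fun n ↦ (P (ψ₀ n)).μ ⟨s, (ℭ.dom_subset (ψ₀ n) (hfull (ψ₀ n) s.2)).1⟩)
        (fun n f hf ↦ (P (ψ₀ n)).isConjugateHeatFlow.lintegral_eq_lintegral_lintegral_condKernel
          (ℭ.dom_subset (ψ₀ n) (hfull (ψ₀ n) s.2)).1 (ℭ.dom_subset (ψ₀ n) (hfull (ψ₀ n) t.2)).1
          hlt.le hf)
        (m t) (m s) ((hconv t t.2).comp hψ₀.tendsto_atTop) ((hconv s s.2).comp hψ₀.tendsto_atTop)
        (D t k).2 (fun n ↦ xD t t.2 k (ψ₀ n)) ((hxD t t.2 k).comp hψ₀.tendsto_atTop)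
      exact ⟨ψ, hψ, fun _ ↦ ⟨ν, hν, hνt⟩⟩
    · exact ⟨id, strictMono_id, fun h ↦ absurd h hlt⟩
  obtain ⟨ψ, hψ, hQ⟩ := exists_strictMono_forall_of_extraction' (P := Q) hsub hex
  refine ⟨ψ, hψ, fun s hs t ht hlt ↦ ?_⟩
  -- the limit kernels along `ψ` at the points of `D t`
  have hQ' : ∀ k : ℕ, ∃ ν : Measure (ℭ.Z ⟨s, hs⟩), IsProbabilityMeasure ν ∧
      Tendsto (fun n ↦ wassersteinW1
        (((P (ψ n)).flow.condKernel (xD t ht k (ψ n))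
            ⟨s, (ℭ.dom_subset (ψ n) (hfull (ψ n) hs)).1⟩).map (ℭ.φ (ψ n) s (hfull (ψ n) hs))) ν)
        atTop (𝓝 0) := fun k ↦ hQ (⟨s, hs⟩, ⟨t, ht⟩, k) hlt
  choose K₀ hK₀P hK₀t using hQ'
  haveI := hK₀P
  haveI : ∀ n (x : (P (ψ n)).flow.Slice ⟨t, (ℭ.dom_subset (ψ n) (hfull (ψ n) ht)).1⟩),
      IsProbabilityMeasure ((P (ψ n)).flow.condKernel x
        ⟨s, (ℭ.dom_subset (ψ n) (hfull (ψ n) hs)).1⟩) := fun n x ↦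
    (P (ψ n)).flow.isProbabilityMeasure_condKernel x hlt.le
  -- the pushed kernels `a n x := (φ^{ψ n}_s)_* ν^{ψ n}_{x;s}`, `1`-Lipschitz in `x`
  set a : ∀ n, (P (ψ n)).flow.Slice ⟨t, (ℭ.dom_subset (ψ n) (hfull (ψ n) ht)).1⟩ →
      Measure (ℭ.Z ⟨s, hs⟩) := fun n x ↦
    ((P (ψ n)).flow.condKernel x ⟨s, (ℭ.dom_subset (ψ n) (hfull (ψ n) hs)).1⟩).map
      (ℭ.φ (ψ n) s (hfull (ψ n) hs)) with ha_def
  haveI : ∀ n x, IsProbabilityMeasure (a n x) := fun n x ↦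
    Measure.isProbabilityMeasure_map (ℭ.isometry _ _ _).continuous.measurable.aemeasurable
  have ha : ∀ n x x', wassersteinW1 (a n x) (a n x') ≤ edist x x' := fun n x x' ↦
    (hP (ψ n)).wassersteinW1_map_condKernel_le_edist hlt.le (ℭ.isometry _ _ _) x x'
  -- `1`-Lipschitz on `D t`, then extended to `supp m_t`
  have hLip : ∀ k l, wassersteinW1 (K₀ k) (K₀ l) ≤ edist (D ⟨t, ht⟩ k) (D ⟨t, ht⟩ l) := by
    intro k l
    rw [Subtype.edist_eq]
    exact wassersteinW1_limit_le_edist_of_tendsto a ha (fun n ↦ ℭ.φ (ψ n) t (hfull (ψ n) ht))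
      (fun n ↦ ℭ.isometry _ _ _) (D := fun k ↦ ((D ⟨t, ht⟩ k : (m ⟨t, ht⟩).support) : ℭ.Z ⟨t, ht⟩))
      (xD := fun k n ↦ xD t ht k (ψ n)) (fun k ↦ (hxD t ht k).comp hψ.tendsto_atTop) hK₀t k l
  obtain ⟨K, hKP, hKL, hK0⟩ := exists_lipschitz_kernel_extension (hD ⟨t, ht⟩) K₀ hLip
  refine ⟨K, D ⟨t, ht⟩, fun k n ↦ xD t ht k (ψ n), hKP, hKL, hD ⟨t, ht⟩,
    fun k ↦ (hxD t ht k).comp hψ.tendsto_atTop, fun k ↦ ?_⟩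
  haveI := hKP (D ⟨t, ht⟩ k)
  refine tendsto_of_tendsto_of_tendsto_of_le_of_le tendsto_const_nhds (hK₀t k) (fun n ↦ bot_le)
    fun n ↦ ?_
  calc wassersteinW1 (a n (xD t ht k (ψ n))) (K (D ⟨t, ht⟩ k))
      ≤ wassersteinW1 (a n (xD t ht k (ψ n))) (K₀ k) + wassersteinW1 (K₀ k) (K (D ⟨t, ht⟩ k)) :=
        wassersteinW1_triangle _ _ _
    _ = wassersteinW1 (a n (xD t ht k (ψ n))) (K₀ k) := by rw [hK0 k, add_zero]

end MetricFlowPair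

end Literature.Geometry.Riemannian

end
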